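import Literature.NumberTheory.LFunctions.AlternativeHypothesisConsequencesProofs
import Literature.NumberTheory.LFunctions.ZeroPairSecondMomentProofs
import HarnessLib

/-!
# GLSS 2026, Theorems 2–4 and Corollary 2 modulo Fujii's mean square (Titchmarsh (9.25.2)) only

LABEL (cell `rh-crit`, corpus C5 `ah`): **NOT RH-BEARING.** Four one-line compositions of tree
theorems; THEOREMS ONLY, no definition, no named fact. bears_on: LADDER-RH §4 HELD «conditional
bridges: exceptional zero ⇒ …». WHAT THIS IS NOT: a claim about RH, AH or (9.25.2); nothing here
bears on the truth of RH.

Goldston–Lee–Schettler–Suriajaya (GLSS 2026, arXiv:2507.06823), Theorems 2, 3, 4 and Corollary 2,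
rest in the tree on the single named fact `glss2026_dsec2` (GLSS §3 (3.2);
`glss2026_theorem2_of_dsec2`, `…theorem3/4_of_dsec2`, `…corollary2_of_dsec2` of
`AlternativeHypothesisConsequencesProofs.lean`), and (3.2) is proved in
`ZeroPairSecondMomentProofs.lean` from Fujii's mean-square asymptotic (Titchmarsh (9.25.2)) taken as
the hypothesis `h252` in the binder shape of `SelbergFujii.first_moment_of_moments`
(`glss2026_dsec2_of_fujii`). This file records the compositions under their own names, so that the
census can cite them: the whole GLSS 2026 block is conditional on (9.25.2) alone — the open
analytic input of the tree's Selberg–Fujii cluster (Selberg's mean-value theorem for `S(t)`,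
`SelbergFujiiApproxFormula.lean`). Kept in a separate light module: importing
`AlternativeHypothesisConsequencesProofs` into `ZeroPairSecondMomentProofs` triples the latter's
elaboration time.

## References

* [GoldstonLeeSchettlerSuriajaya2026] Theorems 2–4, Corollary 2, §3 (3.2).
* [Titchmarsh1986] §9.25 (9.25.2) (Fujii's mean square of `S(t+h) − S(t)`).
-/

noncomputable section

open MeasureTheory Filter
open scoped Real

namespace Literature.NumberTheory.LFunctions

/-- **GLSS 2026, Theorem 2 from Fujii's mean square (Titchmarsh (9.25.2)) alone**
(`glss2026_theorem2_of_dsec2 ∘ glss2026_dsec2_of_fujii`).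
[cite: GoldstonLeeSchettlerSuriajaya2026, Theorem 2] -/
theorem glss2026_theorem2_of_fujii
    (h252 : ∃ A : ℝ, ∃ T₀ : ℝ, ∀ T : ℝ, T₀ ≤ T → ∀ h : ℝ, 0 ≤ h → h ≤ T / 2 →
      |(∫ t in (0 : ℝ)..T, (zetaArgS (t + h) - zetaArgS t) ^ 2) -
          T * Real.log (3 + h * Real.log T) / π ^ 2| ≤
        A * (T * Real.sqrt (Real.log (3 + h * Real.log T)))) :
    glss2026_theorem2 :=
  glss2026_theorem2_of_dsec2 (glss2026_dsec2_of_fujii h252)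

/-- **GLSS 2026, Theorem 3 from (9.25.2) alone** (`glss2026_theorem3_of_dsec2 ∘
glss2026_dsec2_of_fujii`; (AH1) stays the hypothesis inside `glss2026_theorem3`).
[cite: GoldstonLeeSchettlerSuriajaya2026, Theorem 3] -/
theorem glss2026_theorem3_of_fujii
    (h252 : ∃ A : ℝ, ∃ T₀ : ℝ, ∀ T : ℝ, T₀ ≤ T → ∀ h : ℝ, 0 ≤ h → h ≤ T / 2 →
      |(∫ t in (0 : ℝ)..T, (zetaArgS (t + h) - zetaArgS t) ^ 2) -
          T * Real.log (3 + h * Real.log T) / π ^ 2| ≤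
        A * (T * Real.sqrt (Real.log (3 + h * Real.log T)))) :
    glss2026_theorem3 :=
  glss2026_theorem3_of_dsec2 (glss2026_dsec2_of_fujii h252)

/-- **GLSS 2026, Theorem 4 from (9.25.2) alone** (`glss2026_theorem4_of_dsec2 ∘
glss2026_dsec2_of_fujii`). [cite: GoldstonLeeSchettlerSuriajaya2026, Theorem 4] -/
theorem glss2026_theorem4_of_fujii
    (h252 : ∃ A : ℝ, ∃ T₀ : ℝ, ∀ T : ℝ, T₀ ≤ T → ∀ h : ℝ, 0 ≤ h → h ≤ T / 2 →
      |(∫ t in (0 : ℝ)..T, (zetaArgS (t + h) - zetaArgS t) ^ 2) -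
          T * Real.log (3 + h * Real.log T) / π ^ 2| ≤
        A * (T * Real.sqrt (Real.log (3 + h * Real.log T)))) :
    glss2026_theorem4 :=
  glss2026_theorem4_of_dsec2 (glss2026_dsec2_of_fujii h252)

/-- **GLSS 2026, Corollary 2 from (9.25.2) alone** (`glss2026_corollary2_of_dsec2 ∘
glss2026_dsec2_of_fujii`; ESH stays the hypothesis inside `glss2026_corollary2`).
[cite: GoldstonLeeSchettlerSuriajaya2026, Corollary 2] -/
theorem glss2026_corollary2_of_fujii
    (h252 : ∃ A : ℝ, ∃ T₀ : ℝ, ∀ T : ℝ, T₀ ≤ T → ∀ h : ℝ, 0 ≤ h → h ≤ T / 2 →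
      |(∫ t in (0 : ℝ)..T, (zetaArgS (t + h) - zetaArgS t) ^ 2) -
          T * Real.log (3 + h * Real.log T) / π ^ 2| ≤
        A * (T * Real.sqrt (Real.log (3 + h * Real.log T)))) :
    glss2026_corollary2 :=
  glss2026_corollary2_of_dsec2 (glss2026_dsec2_of_fujii h252)

end Literature.NumberTheory.LFunctions

end
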